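import Mathlib
import Literature.NumberTheory.Transcendental.KZCalculus
import Literature.NumberTheory.Transcendental.KZLogCalculusProofs
import Literature.NumberTheory.Transcendental.SemialgebraicLineDeriv
import Summits.KontsevichZagierPeriods.KontsevichZagierPeriods.Theorems.HermiteRigidityGenusTwoCycleTransferPushforwardDimOne
import Summits.KontsevichZagierPeriods.KontsevichZagierPeriods.Theorems.HermiteRigidityGenusTwoCycleTransferSemialgebraicInvFunOn

/-!
# `RichelotChain` (stmt-KontsevichZagierPeriods-6732, route IsogenyCertificates): the two-sheet transfer

Generic Kontsevich–Zagier bookkeeping behind every identity of `RichelotChain`: a representation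
`r = [(lo, hi), g]` in dimension one whose open interval is cut at a rational point `mid`, two maps
`ψ₀ : (lo, mid) → T`, `ψ₁ : (mid, hi) → T` which are `ℚ`-semialgebraic bijections onto the same
set `T` with `ℚ`-semialgebraic nowhere-vanishing derivatives, and a representation `s = [T, f]` whose
integrand is the sum of the two push-forward integrands,
`f (ψ₀ t₀) = g t₀/|ψ₀′ t₀| + g t₁/|ψ₁′ t₁|` whenever `ψ₀ t₀ = ψ₁ t₁` (the "trace identity" of the two
sheets). Then `r` and `s` are KZ-equivalent, in SIX moves: rule (1a) twice
(`(lo,hi) = (lo,mid) ∪ [mid,hi)`, `[mid,hi) = {mid} ∪ (mid,hi)`), once more to discard the point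
`{mid}` (a null domain is a relation: `[t] = [t] + [t]`), rule (2) twice (the one-dimensional
push-forward `stub_pushforwardDimOne` of the tree, with the semialgebraic inverse
`stub_semialgebraicInvFunOn`), and rule (1b) once on `T`.

Also recorded: the elementary semialgebraic sets of `ℝ¹` used as domains (open intervals, a
half-open interval, a point, all with rational endpoints).

References: M. Kontsevich, D. Zagier, *Periods* (2001), §1.2 rules (1), (2); J. Bochnak, M. Coste,
M.-F. Roy, *Real Algebraic Geometry* (1998), §2.2.
-/

noncomputable section

open Set MeasureTheory
open Literature.NumberTheory.Transcendental Literature.ModelTheory.ExponentialFields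
open Summit.KontsevichZagierPeriods.HermiteRigidity.GenusTwoCycleTransfer
  (stub_pushforwardDimOne stub_semialgebraicInvFunOn)

namespace Summit.KontsevichZagierPeriods.IsogenyCertificates.RichelotChain

/-! ### Semialgebraic domains in `ℝ¹` -/

/-- The open interval `{p | a < p 0 < b} ⊆ ℝ¹` with rational endpoints is `ℚ`-semialgebraic.
[cite: BochnakCosteRoy1998, §2.1] -/
theorem isSemialgebraic_Ioo (a b : ℚ) :
    IsSemialgebraic ℚ {p : Fin 1 → ℝ | (a : ℝ) < p 0 ∧ p 0 < (b : ℝ)} := by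
  have h1 := isSemialgebraic_setOf_eval_pos (k := ℚ) (R := ℝ)
    (MvPolynomial.X 0 - MvPolynomial.C a : MvPolynomial (Fin 1) ℚ)
  have h2 := isSemialgebraic_setOf_eval_pos (k := ℚ) (R := ℝ)
    (MvPolynomial.C b - MvPolynomial.X 0 : MvPolynomial (Fin 1) ℚ)
  convert h1.inter h2 using 1
  ext p
  simp only [mem_setOf_eq, mem_inter_iff, map_sub, MvPolynomial.aeval_X, MvPolynomial.aeval_C,
    eq_ratCast, sub_pos]

/-- The half-open interval `{p | a ≤ p 0 < b} ⊆ ℝ¹` with rational endpoints is `ℚ`-semialgebraic.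
[cite: BochnakCosteRoy1998, §2.1] -/
theorem isSemialgebraic_Ico (a b : ℚ) :
    IsSemialgebraic ℚ {p : Fin 1 → ℝ | (a : ℝ) ≤ p 0 ∧ p 0 < (b : ℝ)} := by
  have h1 := isSemialgebraic_setOf_eval_nonneg (k := ℚ) (R := ℝ)
    (MvPolynomial.X 0 - MvPolynomial.C a : MvPolynomial (Fin 1) ℚ)
  have h2 := isSemialgebraic_setOf_eval_pos (k := ℚ) (R := ℝ)
    (MvPolynomial.C b - MvPolynomial.X 0 : MvPolynomial (Fin 1) ℚ)
  have e : {p : Fin 1 → ℝ | (a : ℝ) ≤ p 0 ∧ p 0 < (b : ℝ)} =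
      {x : Fin 1 → ℝ | 0 ≤ MvPolynomial.aeval x (MvPolynomial.X 0 - MvPolynomial.C a : MvPolynomial (Fin 1) ℚ)} ∩
        {x : Fin 1 → ℝ | 0 < MvPolynomial.aeval x (MvPolynomial.C b - MvPolynomial.X 0 : MvPolynomial (Fin 1) ℚ)} := by
    ext p
    simp only [mem_setOf_eq, mem_inter_iff, map_sub, MvPolynomial.aeval_X, MvPolynomial.aeval_C,
      eq_ratCast, sub_pos, sub_nonneg]
  rw [e]
  exact h1.inter h2

/-- The point `{p | p 0 = a} ⊆ ℝ¹` with rational coordinate is `ℚ`-semialgebraic.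
[cite: BochnakCosteRoy1998, §2.1] -/
theorem isSemialgebraic_point (a : ℚ) :
    IsSemialgebraic ℚ {p : Fin 1 → ℝ | p 0 = (a : ℝ)} := by
  have h1 := isSemialgebraic_setOf_eval_eq_zero (k := ℚ) (R := ℝ)
    (MvPolynomial.X 0 - MvPolynomial.C a : MvPolynomial (Fin 1) ℚ)
  convert h1 using 1
  ext p
  simp only [mem_setOf_eq, map_sub, MvPolynomial.aeval_X, MvPolynomial.aeval_C, eq_ratCast,
    sub_eq_zero]

/-- The image of `{p | p 0 ∈ S}` under `p ↦ (φ (p 0))` is `{q | q 0 ∈ φ '' S}`. [folklore] -/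
theorem image_fin_one (φ : ℝ → ℝ) (S : Set ℝ) :
    (fun p : Fin 1 → ℝ => fun _ : Fin 1 => φ (p 0)) '' {p | p 0 ∈ S} = {q | q 0 ∈ φ '' S} := by
  ext q
  simp only [mem_image, mem_setOf_eq]
  constructor
  · rintro ⟨p, hp, rfl⟩
    exact ⟨p 0, hp, rfl⟩
  · rintro ⟨t, ht, hq⟩
    refine ⟨fun _ => t, ht, ?_⟩
    funext i
    rw [hq, Fin.fin_one_eq_zero i]

/-! ### One sheet: the push-forward of a restricted representation onto `T` -/

/-- **One sheet.** Push-forward of `r` restricted to the open sub-interval `(a, b)` of its domain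
along `ψ`, a `ℚ`-semialgebraic injection of `(a, b)` onto `T` with `ℚ`-semialgebraic nowhere-zero
derivative `ψ′`: a representation `s'` with domain `{q | q 0 ∈ T}`, integrand
`g t / |ψ′ t|` at `ψ t`, and `[r|(a,b)] − [s'] ∈ KZ.changeOfVariablesRel`.
[cite: KontsevichZagier2001, §1.2 rule (2)] -/
theorem sheet_pushforward (r : KZ.IntegralRep 1) (a b : ℚ) (T : Set ℝ) (g ψ ψ' : ℝ → ℝ)
    (hsub : {p : Fin 1 → ℝ | (a : ℝ) < p 0 ∧ p 0 < (b : ℝ)} ⊆ r.domain)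
    (hg : EqOn r.integrand (fun p => g (p 0)) r.domain)
    (hψ : IsSemialgebraicFunOn ℚ {p : Fin 1 → ℝ | (a : ℝ) < p 0 ∧ p 0 < (b : ℝ)} (fun p => ψ (p 0)))
    (hψ' : IsSemialgebraicFunOn ℚ {p : Fin 1 → ℝ | (a : ℝ) < p 0 ∧ p 0 < (b : ℝ)} (fun p => ψ' (p 0)))
    (hder : ∀ t : ℝ, (a : ℝ) < t → t < (b : ℝ) → HasDerivAt ψ (ψ' t) t)
    (hne : ∀ t : ℝ, (a : ℝ) < t → t < (b : ℝ) → ψ' t ≠ 0)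
    (hinj : InjOn ψ (Ioo (a : ℝ) b)) (himg : ψ '' Ioo (a : ℝ) b = T) :
    ∃ s' : KZ.IntegralRep 1, s'.domain = {q | q 0 ∈ T} ∧
      (∀ t : ℝ, (a : ℝ) < t → t < (b : ℝ) → s'.integrand (fun _ => ψ t) = g t / |ψ' t|) ∧
      KZ.of (r.restrict _ (isSemialgebraic_Ioo a b) hsub) - KZ.of s' ∈ KZ.changeOfVariablesRel := by
  set σ : Set (Fin 1 → ℝ) := {p | (a : ℝ) < p 0 ∧ p 0 < b} with hσ_def
  set r₀ : KZ.IntegralRep 1 := r.restrict σ (isSemialgebraic_Ioo a b) hsub with hr₀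
  set Φ : (Fin 1 → ℝ) → (Fin 1 → ℝ) := fun p _ => ψ (p 0) with hΦ_def
  have hΦsa : IsSemialgebraicMapOn ℚ σ Φ :=
    IsSemialgebraicMapOn.of_forall (isSemialgebraic_Ioo a b) fun _ => hψ
  have hΦinj : InjOn Φ σ := by
    intro p hp p' hp' h
    have h0 : ψ (p 0) = ψ (p' 0) := congrFun h 0
    have h1 := hinj hp hp' h0
    funext i
    rw [Fin.fin_one_eq_zero i, h1]
  have hG : IsSemialgebraicMapOn ℚ (Φ '' σ) (Function.invFunOn Φ σ) :=
    stub_semialgebraicInvFunOn hΦsa hΦinj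
  have hGφ : ∀ p ∈ σ, Function.invFunOn Φ σ (Φ p) = p := fun p hp =>
    hΦinj.leftInvOn_invFunOn hp
  obtain ⟨s', hsd, hsi, hrel⟩ := stub_pushforwardDimOne r₀ ψ ψ' (Function.invFunOn Φ σ) hψ hψ'
    (fun p hp => hder (p 0) hp.1 hp.2) (fun p hp => hne (p 0) hp.1 hp.2) hG hGφ
  refine ⟨s', ?_, fun t hat htb => ?_, hrel⟩
  · rw [hsd]
    have : σ = {p : Fin 1 → ℝ | p 0 ∈ Ioo (a : ℝ) b} := rfl
    rw [KZ.IntegralRep.domain_restrict, this, image_fin_one, himg]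
  · have hp : (fun _ : Fin 1 => t) ∈ r₀.domain := ⟨hat, htb⟩
    have h1 : s'.integrand (fun _ => ψ t) = r₀.integrand (fun _ => t) / |ψ' t| := hsi _ hp
    rw [h1, KZ.IntegralRep.integrand_restrict, hg (hsub ⟨hat, htb⟩)]

/-! ### Two sheets: the transfer -/

/-- **The two-sheet transfer.** Let `r = [(lo,hi), g]` and `s = [T, f]` be one-dimensional
representations (integrands prescribed on the domains), `lo < mid < hi` rational, and let
`ψ₀ : (lo,mid) → T`, `ψ₁ : (mid,hi) → T` be `ℚ`-semialgebraic injections onto `T` with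
`ℚ`-semialgebraic nowhere-zero derivatives `ψ₀′`, `ψ₁′`. If the trace identity
`f (ψ₀ t₀) = g t₀/|ψ₀′ t₀| + g t₁/|ψ₁′ t₁|` holds whenever `ψ₀ t₀ = ψ₁ t₁`, then `r` and `s` are
KZ-equivalent (three moves of rule (1a), two of rule (2), one of rule (1b)).
[cite: KontsevichZagier2001, §1.2 rules (1), (2)] -/
theorem two_sheet_transfer (r s : KZ.IntegralRep 1) (lo mid hi : ℚ) (T : Set ℝ)
    (g f ψ₀ ψ₀' ψ₁ ψ₁' : ℝ → ℝ) (hlm : lo < mid) (hmh : mid < hi)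
    (hr : r.domain = {p | (lo : ℝ) < p 0 ∧ p 0 < (hi : ℝ)})
    (hg : EqOn r.integrand (fun p => g (p 0)) r.domain)
    (hs : s.domain = {q | q 0 ∈ T})
    (hf : EqOn s.integrand (fun q => f (q 0)) s.domain)
    (hψ₀ : IsSemialgebraicFunOn ℚ {p : Fin 1 → ℝ | (lo : ℝ) < p 0 ∧ p 0 < (mid : ℝ)} (fun p => ψ₀ (p 0)))
    (hψ₀' : IsSemialgebraicFunOn ℚ {p : Fin 1 → ℝ | (lo : ℝ) < p 0 ∧ p 0 < (mid : ℝ)} (fun p => ψ₀' (p 0)))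
    (hd₀ : ∀ t : ℝ, (lo : ℝ) < t → t < (mid : ℝ) → HasDerivAt ψ₀ (ψ₀' t) t)
    (hn₀ : ∀ t : ℝ, (lo : ℝ) < t → t < (mid : ℝ) → ψ₀' t ≠ 0)
    (hi₀ : InjOn ψ₀ (Ioo (lo : ℝ) mid)) (him₀ : ψ₀ '' Ioo (lo : ℝ) mid = T)
    (hψ₁ : IsSemialgebraicFunOn ℚ {p : Fin 1 → ℝ | (mid : ℝ) < p 0 ∧ p 0 < (hi : ℝ)} (fun p => ψ₁ (p 0)))
    (hψ₁' : IsSemialgebraicFunOn ℚ {p : Fin 1 → ℝ | (mid : ℝ) < p 0 ∧ p 0 < (hi : ℝ)} (fun p => ψ₁' (p 0)))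
    (hd₁ : ∀ t : ℝ, (mid : ℝ) < t → t < (hi : ℝ) → HasDerivAt ψ₁ (ψ₁' t) t)
    (hn₁ : ∀ t : ℝ, (mid : ℝ) < t → t < (hi : ℝ) → ψ₁' t ≠ 0)
    (hi₁ : InjOn ψ₁ (Ioo (mid : ℝ) hi)) (him₁ : ψ₁ '' Ioo (mid : ℝ) hi = T)
    (htr : ∀ t₀ t₁ : ℝ, (lo : ℝ) < t₀ → t₀ < (mid : ℝ) → (mid : ℝ) < t₁ → t₁ < (hi : ℝ) → ψ₀ t₀ = ψ₁ t₁ →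
      f (ψ₀ t₀) = g t₀ / |ψ₀' t₀| + g t₁ / |ψ₁' t₁|) :
    KZ.Equivalent r s := by
  have hlm' : (lo : ℝ) < mid := by exact_mod_cast hlm
  have hmh' : (mid : ℝ) < hi := by exact_mod_cast hmh
  -- the four pieces of the source domain
  have hsub₀ : {p : Fin 1 → ℝ | (lo : ℝ) < p 0 ∧ p 0 < (mid : ℝ)} ⊆ r.domain := fun p hp => by
    rw [hr]; exact ⟨hp.1, hp.2.trans hmh'⟩
  have hsub₁ : {p : Fin 1 → ℝ | (mid : ℝ) < p 0 ∧ p 0 < (hi : ℝ)} ⊆ r.domain := fun p hp => by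
    rw [hr]; exact ⟨hlm'.trans hp.1, hp.2⟩
  have hsubge : {p : Fin 1 → ℝ | (mid : ℝ) ≤ p 0 ∧ p 0 < (hi : ℝ)} ⊆ r.domain := fun p hp => by
    rw [hr]; exact ⟨hlm'.trans_le hp.1, hp.2⟩
  have hsubm : {p : Fin 1 → ℝ | p 0 = (mid : ℝ)} ⊆ r.domain := fun p hp => by
    rw [hr]
    have hp' : p 0 = mid := hp
    exact ⟨by rw [hp']; exact hlm', by rw [hp']; exact hmh'⟩
  set r₀ := r.restrict _ (isSemialgebraic_Ioo lo mid) hsub₀ with hr₀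
  set r₁ := r.restrict _ (isSemialgebraic_Ioo mid hi) hsub₁ with hr₁
  set rge := r.restrict _ (isSemialgebraic_Ico mid hi) hsubge with hrge
  set rm := r.restrict _ (isSemialgebraic_point mid) hsubm with hrm
  -- move 1 (rule 1a): (lo,hi) = (lo,mid) ∪ [mid,hi)
  have hA1 : KZ.of r - KZ.of r₀ - KZ.of rge ∈ KZ.relations := by
    refine KZ.domainAddRel_subset_relations ⟨1, r, r₀, rge, ?_, ?_, fun _ _ => rfl, fun _ _ => rfl, rfl⟩
    · rw [KZ.IntegralRep.domain_restrict, KZ.IntegralRep.domain_restrict, hr]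
      ext p
      simp only [mem_setOf_eq, mem_union]
      constructor
      · rintro ⟨h1, h2⟩
        rcases lt_or_ge (p 0) mid with h | h
        · exact Or.inl ⟨h1, h⟩
        · exact Or.inr ⟨h, h2⟩
      · rintro (⟨h1, h2⟩ | ⟨h1, h2⟩)
        · exact ⟨h1, h2.trans hmh'⟩
        · exact ⟨hlm'.trans_le h1, h2⟩
    · have he : r₀.domain ∩ rge.domain = ∅ := by
        rw [KZ.IntegralRep.domain_restrict, KZ.IntegralRep.domain_restrict]
        ext p
        simp only [mem_inter_iff, mem_setOf_eq, mem_empty_iff_false, iff_false]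
        rintro ⟨h, h'⟩
        linarith [h.2, h'.1]
      rw [he, measure_empty]
  -- move 2 (rule 1a): [mid,hi) = {mid} ∪ (mid,hi)
  have hA2 : KZ.of rge - KZ.of rm - KZ.of r₁ ∈ KZ.relations := by
    refine KZ.domainAddRel_subset_relations ⟨1, rge, rm, r₁, ?_, ?_, fun _ _ => rfl, fun _ _ => rfl, rfl⟩
    · rw [KZ.IntegralRep.domain_restrict, KZ.IntegralRep.domain_restrict, KZ.IntegralRep.domain_restrict]
      ext p
      simp only [mem_setOf_eq, mem_union]
      constructor
      · rintro ⟨h1, h2⟩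
        rcases h1.lt_or_eq with h | h
        · exact Or.inr ⟨h, h2⟩
        · exact Or.inl h.symm
      · rintro (h | ⟨h1, h2⟩)
        · exact ⟨h.symm.le, by rw [h]; exact hmh'⟩
        · exact ⟨h1.le, h2⟩
    · have he : rm.domain ∩ r₁.domain = ∅ := by
        rw [KZ.IntegralRep.domain_restrict, KZ.IntegralRep.domain_restrict]
        ext p
        simp only [mem_inter_iff, mem_setOf_eq, mem_empty_iff_false, iff_false]
        rintro ⟨h, h'⟩
        have h0 : p 0 = (mid : ℝ) := h
        linarith [h'.1]
      rw [he, measure_empty]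
  -- move 3 (rule 1a): the point is a relation
  have hA3 : KZ.of rm ∈ KZ.relations := by
    refine KZ.of_mem_relations_of_volume_eq_zero rm ?_
    rw [KZ.IntegralRep.domain_restrict]
    have e : {p : Fin 1 → ℝ | p 0 = (mid : ℝ)} = {fun _ => (mid : ℝ)} := by
      ext p
      simp only [mem_setOf_eq, mem_singleton_iff]
      constructor
      · intro h
        funext i
        rw [Fin.fin_one_eq_zero i, h]
      · intro h
        rw [h]
    rw [e, measure_singleton]
  -- moves 4, 5 (rule 2): the two sheets
  obtain ⟨s₀, hs₀d, hs₀i, hC₀⟩ := sheet_pushforward r lo mid T g ψ₀ ψ₀' hsub₀ hg hψ₀ hψ₀' hd₀ hn₀ hi₀ him₀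
  obtain ⟨s₁, hs₁d, hs₁i, hC₁⟩ := sheet_pushforward r mid hi T g ψ₁ ψ₁' hsub₁ hg hψ₁ hψ₁' hd₁ hn₁ hi₁ him₁
  -- move 6 (rule 1b): the trace identity on T
  have hB : KZ.of s - KZ.of s₀ - KZ.of s₁ ∈ KZ.relations := by
    refine KZ.integrandAddRel_subset_relations ⟨1, s, s₀, s₁, by rw [hs₀d, hs], by rw [hs₁d, hs], ?_, rfl⟩
    intro q hq
    have hqT : q 0 ∈ T := by rw [hs] at hq; exact hq
    obtain ⟨t₀, ht₀, h0⟩ : q 0 ∈ ψ₀ '' Ioo (lo : ℝ) mid := by rw [him₀]; exact hqT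
    obtain ⟨t₁, ht₁, h1⟩ : q 0 ∈ ψ₁ '' Ioo (mid : ℝ) hi := by rw [him₁]; exact hqT
    have hq0 : q = fun _ => ψ₀ t₀ := by
      funext i
      rw [Fin.fin_one_eq_zero i, h0]
    rw [Pi.add_apply, hf hq]
    rw [hq0] at *
    have e1 : s₁.integrand (fun _ => ψ₀ t₀) = g t₁ / |ψ₁' t₁| := by
      rw [show (fun _ : Fin 1 => ψ₀ t₀) = fun _ => ψ₁ t₁ from by rw [h0, h1]]
      exact hs₁i t₁ ht₁.1 ht₁.2
    rw [hs₀i t₀ ht₀.1 ht₀.2, e1]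
    exact htr t₀ t₁ ht₀.1 ht₀.2 ht₁.1 ht₁.2 (h0.trans h1.symm)
  -- compose
  have hC₀' := KZ.changeOfVariablesRel_subset_relations hC₀
  have hC₁' := KZ.changeOfVariablesRel_subset_relations hC₁
  have h := KZ.relations.sub_mem (KZ.relations.add_mem (KZ.relations.add_mem
    (KZ.relations.add_mem (KZ.relations.add_mem hA1 hA2) hA3) hC₀') hC₁') hB
  show KZ.of r - KZ.of s ∈ KZ.relations
  convert h using 1
  abel

end Summit.KontsevichZagierPeriods.IsogenyCertificates.RichelotChain

end
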